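import Summits.HubbardSuperconductivity.HubbardSuperconductivity.Theorems.WidthHaldaneTubeTwistedPlaneWaves
import Summits.HubbardSuperconductivity.HubbardSuperconductivity.Theorems.WidthHaldaneTubeKineticWindow
import Summits.HubbardSuperconductivity.HubbardSuperconductivity.Theorems.WidthHaldaneTubeEtaPairing

/-!
# `SeamGluingLocality` (stmt-HubbardSuperconductivity-18509), negative side: the THRESHOLD-FREE form
# is false at SMALL POSITIVE coupling — the `4 × 4` Hubbard torus at `n = 3/4`, `0 ≤ U ≤ 1/100` is
# paramagnetic at the twist `π/3`

The disprover's second near-miss of `Cruxes/SeamGluingLocality/Disproof.lean` §3,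
`not_seamGluingLocalityAllSizes` (the crux with NO thresholds, `M₂ = L₂ = 0`, factor `1`), was rated
"numerically refutable (ED of the `8008²`-dimensional `4 × 4` sector), uncertifiable in Lean". It IS
certifiable, with no numerics at all: the threshold-free form still quantifies over EVERY `U > 0`, and
at a FIXED size the free (`U = 0`) violation transfers to small `U > 0` by the two elementary
couplings bounds (the uniform-in-size transfer is what fails, `Disproof.lean` §5 (2)). Sorry-free:

* `tubeEnergy_le_free_add` — for `U ≥ 0`, every twist `θ` and `2n ≤ 2LM`:
  `E_{L,M}(U; θ, 2n) ≤ E_{L,M}(0; θ, 2n) + U·n` (price a free twisted sector ground state: its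
  interaction energy is `U⟨Σ n↑n↓⟩ ≤ U·N↓`; the twisted analogue of
  `WidthHaldaneTubeKineticWindow.tubeEnergy_zero_le_free_add`);
* `tubeEnergy_free_le` — and `E_{L,M}(0; θ, 2n) ≤ E_{L,M}(U; θ, 2n)` (`Σ n↑n↓ ≥ 0`);
* `tubeEnergy_four_four_twist_lt` — on the `4 × 4` torus (any labelling) with `12` electrons,
  `E(U; π/3, 12) < E(U; 0, 12)` for `0 ≤ U ≤ 1/100`: the free Fermi sea `F = {(0,0), (±1,0), (0,±1),
  (1,1)}` is a Fermi set of the untwisted band (`tubeEnergy_free_eq`: `E(0;0,12) = 2Σ_F ε`), the same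
  six momenta price the twisted floor (`tubeEnergy_free_twisted_le`), and
  `2Σ_F (ε^{π/3} - ε) = 12 - 12cos(π/12) - 4cos(5π/12) < -0.14` (`cos x ≥ 1 - x²/2`, `π < 3.15`),
  which beats the interaction allowance `6U ≤ 0.06`;
* `tubeStiffness_four_four_neg` — hence `ρ̃_{4,4}(U, 1/4) < 0` for `0 ≤ U ≤ 1/100`
  (`N_{4,4}(1/4) = 12`): an INTERACTING admissible glued tube (`4 = 2 + 2 ≤ L = 4`) violating the
  hidden sign claim (i) of the crux;
* **`not_seamGluingLocality_allSizes`** — the verbatim negation of `SeamGluingLocalityAllSizes`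
  (instance `U = 1/100`, `δ = 1/4`, `L = 4`, `M' = M'' = 2`, `M = 4`, canonical `Fin` carriers;
  conjunct (1) reads `0 ≤ max(min ρ̃' ρ̃'', 0) ≤ ρ̃_{4,4} < 0`); closes that `sorry` by `exact`.

Reading (for the planner / disprover). This does NOT touch the crux (its `∃ M₂ L₂` absorbs any
finite set of sizes) but makes precise in Lean that the thresholds of `C` cannot be dropped: at a
fixed admissible size a free (`U = 0`) violation of §3 survives for `U` below a size-dependent
constant (certified here for `U ≤ 1/100` at `4 × 4`; the bound used allows `U < 0.0235`). ED (item evidence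
`compute-j024528.json`, c1 lead) shows the same `4 × 4` gluing is paramagnetic at `U = 2, 4, 8` as well
(`ρ̃ = -1.09, -1.00, -0.76`), far beyond the perturbative window certified here. Folklore
finite-dimensional statements (BCS 1957 §II Fermi seas; Scalapino–White–Zhang 1993 §II stiffness
criterion; Byers–Yang 1961); no definitions, no named facts. REUSED: `tubeEnergy_free_eq`,
`tubeEnergy_free_twisted_le`, `exists_isGroundStateInSector_tubeH`, `re_expect_doublon_le`,
`tubeH0_eq_zero_add_smul`, `HubbardBandBottom.re_rayleigh_doublon_nonneg`.
-/

noncomputable section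

namespace Summit.HubbardSuperconductivity.HubbardSuperconductivity.Theorems.SeamGluingLocality.Negative

set_option linter.dupNamespace false -- summit = problem name (single-conjunct summit), D-0017

open scoped BigOperators Matrix ComplexConjugate
open Matrix Literature.MathematicalPhysics.QuantumLattice
open Summit.HubbardSuperconductivity.HubbardSuperconductivity.Theorems.WidthHaldane

/-! ### Coupling bounds at a fixed twist -/

section Coupling

variable (L M : ℕ) [NeZero L] [NeZero M] (Λ : Type) [LinearOrder Λ] [Fintype Λ]
  (e : Λ ≃ ZMod L × ZMod M)

/-- **The repulsive twisted floor is at most the free twisted floor plus `U·N/2`**: for `U ≥ 0`,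
every twist `θ` and `n ≤ LM`, `E_{L,M}(U; θ, 2n) ≤ E_{L,M}(0; θ, 2n) + U·n` — price a normalised
FREE sector ground state of `H₀(0) + Tw_θ` in `H₀(U) + Tw_θ`: the twist term is common, the
interaction energy is `U⟨Σ_x n_{x↑}n_{x↓}⟩ ≤ U·N↓ = U·n`. [folklore] -/
theorem tubeEnergy_le_free_add (U : ℝ) (hU : 0 ≤ U) (θ : ℝ) {n : ℕ} (hn : n ≤ L * M) :
    tubeEnergy L M Λ e U θ (2 * n) ≤ tubeEnergy L M Λ e 0 θ (2 * n) + U * n := by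
  obtain ⟨φ₀, hgs₀⟩ := exists_isGroundStateInSector_tubeH L M Λ e 0 θ hn
  obtain ⟨c, hc0, hc1⟩ := exists_smul_unit hgs₀.2.1
  have hgs := isGroundStateInSector_smul Λ hgs₀ hc0
  have hφ := hgs.1
  have hle : tubeEnergy L M Λ e U θ (2 * n) ≤
      (expect (tubeH0 L M Λ e U + tubeTwist L M Λ e θ) (c • φ₀)).re := by
    rw [tubeEnergy_eq]
    exact minEnergyOn_le_rayleigh_of_mem (isHermitian_tubeH L M Λ e U θ) _ hφ hc1
  have hfree : (expect (tubeH0 L M Λ e 0 + tubeTwist L M Λ e θ) (c • φ₀)).re =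
      tubeEnergy L M Λ e 0 θ (2 * n) := by
    rw [expect, hgs.2.2, dotProduct_smul, hc1, smul_eq_mul, mul_one, Complex.ofReal_re, tubeEnergy_eq]
  have hsec : IsInSector n n (c • φ₀) := by
    rw [← mem_szSector_iff_isInSector, ← szSector_two_mul_zero_eq]
    exact hφ
  have hD := re_expect_doublon_le Λ hsec
  rw [normSq_eq_one_of_unit Λ hc1, mul_one] at hD
  have hsplit : (expect (tubeH0 L M Λ e U + tubeTwist L M Λ e θ) (c • φ₀)).re =
      (expect (tubeH0 L M Λ e 0 + tubeTwist L M Λ e θ) (c • φ₀)).re +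
        U * (expect (∑ x : Λ, numberOp x 0 * numberOp x 1) (c • φ₀)).re := by
    rw [tubeH0_eq_zero_add_smul L M Λ e U, add_right_comm, expect_add, expect_smul, Complex.add_re,
      Complex.re_ofReal_mul]
  rw [hsplit, hfree] at hle
  nlinarith [mul_le_mul_of_nonneg_left hD hU]

/-- **The free twisted floor is below the repulsive one**: for `U ≥ 0`, `E_{L,M}(0; θ, 2n) ≤
E_{L,M}(U; θ, 2n)` (price a normalised sector ground state of `H₀(U) + Tw_θ` in the free
Hamiltonian and drop `U⟨Σ n↑n↓⟩ ≥ 0`). [folklore] -/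
theorem tubeEnergy_free_le (U : ℝ) (hU : 0 ≤ U) (θ : ℝ) {n : ℕ} (hn : n ≤ L * M) :
    tubeEnergy L M Λ e 0 θ (2 * n) ≤ tubeEnergy L M Λ e U θ (2 * n) := by
  obtain ⟨φ₀, hgs₀⟩ := exists_isGroundStateInSector_tubeH L M Λ e U θ hn
  obtain ⟨c, hc0, hc1⟩ := exists_smul_unit hgs₀.2.1
  have hgs := isGroundStateInSector_smul Λ hgs₀ hc0
  have hφ := hgs.1
  have hle : tubeEnergy L M Λ e 0 θ (2 * n) ≤
      (expect (tubeH0 L M Λ e 0 + tubeTwist L M Λ e θ) (c • φ₀)).re := by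
    rw [tubeEnergy_eq]
    exact minEnergyOn_le_rayleigh_of_mem (isHermitian_tubeH L M Λ e 0 θ) _ hφ hc1
  have hval : (expect (tubeH0 L M Λ e U + tubeTwist L M Λ e θ) (c • φ₀)).re =
      tubeEnergy L M Λ e U θ (2 * n) := by
    rw [expect, hgs.2.2, dotProduct_smul, hc1, smul_eq_mul, mul_one, Complex.ofReal_re, tubeEnergy_eq]
  have hsplit : (expect (tubeH0 L M Λ e U + tubeTwist L M Λ e θ) (c • φ₀)).re =
      (expect (tubeH0 L M Λ e 0 + tubeTwist L M Λ e θ) (c • φ₀)).re +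
        U * (expect (∑ x : Λ, numberOp x 0 * numberOp x 1) (c • φ₀)).re := by
    rw [tubeH0_eq_zero_add_smul L M Λ e U, add_right_comm, expect_add, expect_smul, Complex.add_re,
      Complex.re_ofReal_mul]
  have hD0 : 0 ≤ U * (expect (∑ x : Λ, numberOp x 0 * numberOp x 1) (c • φ₀)).re :=
    mul_nonneg hU (HubbardBandBottom.re_rayleigh_doublon_nonneg _)
  linarith

end Coupling

/-! ### The `4 × 4` torus at `12` electrons: free values -/

section FourByFour

/-- The untwisted `x`- (and `y`-) band factor of the `4 × 4` torus on representatives. -/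
private theorem band_factor_four {j : ℕ} (hj : j < 4) :
    -2 * Real.cos (2 * Real.pi * (j : ℝ) / 4) =
      if j = 0 then -2 else if j = 2 then 2 else 0 := by
  interval_cases j
  · simp
  · rw [show 2 * Real.pi * ((1 : ℕ) : ℝ) / 4 = Real.pi / 2 by push_cast; ring, Real.cos_pi_div_two]
    norm_num
  · rw [show 2 * Real.pi * ((2 : ℕ) : ℝ) / 4 = Real.pi by push_cast; ring, Real.cos_pi]
    norm_num
  · rw [show 2 * Real.pi * ((3 : ℕ) : ℝ) / 4 = Real.pi / 2 + Real.pi by push_cast; ring,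
      Real.cos_add_pi, Real.cos_pi_div_two]
    norm_num

/-- The twisted `x`-band factor of the `4 × 4` torus at `θ = π/3` on the representatives `0, 1, 3`
(`cos(-π/12) = cos(π/12)`, `cos(17π/12) = -cos(5π/12)`). -/
private theorem twistedBand_factor_four {j : ℕ} (hj : j < 4) (hj2 : j ≠ 2) :
    -2 * Real.cos ((2 * Real.pi * (j : ℝ) - Real.pi / 3) / 4) =
      if j = 0 then -2 * Real.cos (Real.pi / 12)
        else if j = 1 then -2 * Real.cos (5 * Real.pi / 12) else 2 * Real.cos (5 * Real.pi / 12) := by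
  interval_cases j
  · rw [show (2 * Real.pi * ((0 : ℕ) : ℝ) - Real.pi / 3) / 4 = -(Real.pi / 12) by push_cast; ring,
      Real.cos_neg]
    simp
  · rw [show (2 * Real.pi * ((1 : ℕ) : ℝ) - Real.pi / 3) / 4 = 5 * Real.pi / 12 by push_cast; ring]
    simp
  · exact absurd rfl hj2
  · rw [show (2 * Real.pi * ((3 : ℕ) : ℝ) - Real.pi / 3) / 4 = 5 * Real.pi / 12 + Real.pi by
        push_cast; ring, Real.cos_add_pi]
    norm_num

/-! The Fermi sea of `6` momenta per spin of the free `4 × 4` torus (filling `12 = N_{4,4}(1/4)`) is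
`F = {(0,0), (1,0), (3,0), (0,1), (0,3), (1,1)}` (levels `-4, -2, -2, -2, -2, 0`); it is written out as a
`Finset` literal below (no definition is introduced). -/

/-- The Fermi sea has six momenta. -/
private theorem card_fermiSea44 : ({((0 : ZMod 4), (0 : ZMod 4)), (1, 0), (3, 0), (0, 1), (0, 3), (1, 1)} : Finset (ZMod 4 × ZMod 4)).card = 6 := by decide

/-- Representative of `0 : ℤ/4`. -/
private theorem zv0 : (0 : ZMod 4).val = 0 := rfl
/-- Representative of `1 : ℤ/4`. -/
private theorem zv1 : (1 : ZMod 4).val = 1 := rfl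
/-- Representative of `3 : ℤ/4`. -/
private theorem zv3 : (3 : ZMod 4).val = 3 := rfl

/-- An element of `ℤ/4` is the cast of its representative. -/
private theorem val_zmod_four (a : ZMod 4) : a = ((a.val : ℕ) : ZMod 4) := (ZMod.natCast_zmod_val a).symm

/-- The `4 × 4` band in terms of the factors. -/
private theorem tubeBand_four_four (k : ZMod 4 × ZMod 4) :
    tubeBand 4 4 k = -2 * Real.cos (2 * Real.pi * (k.1.val : ℝ) / 4) +
      -2 * Real.cos (2 * Real.pi * (k.2.val : ℝ) / 4) := by
  simp only [tubeBand]
  push_cast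
  ring

/-- The twisted `4 × 4` band in terms of the factors. -/
private theorem tubeTwistedBand_four_four (θ : ℝ) (k : ZMod 4 × ZMod 4) :
    tubeTwistedBand 4 4 θ k = -2 * Real.cos ((2 * Real.pi * (k.1.val : ℝ) - θ) / 4) +
      -2 * Real.cos (2 * Real.pi * (k.2.val : ℝ) / 4) := by
  simp only [tubeTwistedBand]
  push_cast
  ring

/-- `F` is below the Fermi level `0`. -/
private theorem fermiSea44_le : ∀ k ∈ ({((0 : ZMod 4), (0 : ZMod 4)), (1, 0), (3, 0), (0, 1), (0, 3), (1, 1)} : Finset (ZMod 4 × ZMod 4)), tubeBand 4 4 k ≤ 0 := by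
  intro k hk
  rw [tubeBand_four_four, band_factor_four k.1.val_lt, band_factor_four k.2.val_lt]
  simp only [Finset.mem_insert, Finset.mem_singleton] at hk
  rcases hk with rfl | rfl | rfl | rfl | rfl | rfl <;> norm_num [zv0, zv1, zv3]

/-- Its complement is above the Fermi level `0`. -/
private theorem fermiSea44_ge : ∀ k ∉ ({((0 : ZMod 4), (0 : ZMod 4)), (1, 0), (3, 0), (0, 1), (0, 3), (1, 1)} : Finset (ZMod 4 × ZMod 4)), 0 ≤ tubeBand 4 4 k := by
  rintro ⟨a, b⟩ hk
  rw [tubeBand_four_four, band_factor_four a.val_lt, band_factor_four b.val_lt]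
  have ha := val_zmod_four a
  have hb := val_zmod_four b
  have ha4 := a.val_lt
  have hb4 := b.val_lt
  generalize a.val = p at *
  generalize b.val = q at *
  subst ha hb
  interval_cases p <;> interval_cases q <;>
    first
      | (norm_num; done)
      | exact absurd (by decide) hk

/-- The free untwisted floor of the `4 × 4` torus at `12` electrons is the `F` sum. -/
private theorem tubeEnergy_four_four_free_zero (Λ : Type) [LinearOrder Λ] [Fintype Λ]
    (e : Λ ≃ ZMod 4 × ZMod 4) :
    tubeEnergy 4 4 Λ e 0 0 12 = 2 * ∑ k ∈ ({((0 : ZMod 4), (0 : ZMod 4)), (1, 0), (3, 0), (0, 1), (0, 3), (1, 1)} : Finset (ZMod 4 × ZMod 4)), tubeBand 4 4 k := by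
  have h := tubeEnergy_free_eq e (by norm_num : 3 ≤ 4) (by norm_num : 3 ≤ 4) ({((0 : ZMod 4), (0 : ZMod 4)), (1, 0), (3, 0), (0, 1), (0, 3), (1, 1)} : Finset (ZMod 4 × ZMod 4)) 0
    fermiSea44_le fermiSea44_ge
  rwa [card_fermiSea44] at h

/-- The free twisted floor of the `4 × 4` torus at `12` electrons is at most the twisted `F`
sum. -/
private theorem tubeEnergy_four_four_free_twist_le (Λ : Type) [LinearOrder Λ] [Fintype Λ]
    (e : Λ ≃ ZMod 4 × ZMod 4) :
    tubeEnergy 4 4 Λ e 0 (Real.pi / 3) 12 ≤ 2 * ∑ k ∈ ({((0 : ZMod 4), (0 : ZMod 4)), (1, 0), (3, 0), (0, 1), (0, 3), (1, 1)} : Finset (ZMod 4 × ZMod 4)), tubeTwistedBand 4 4 (Real.pi / 3) k := by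
  have h := tubeEnergy_free_twisted_le e (by norm_num : 3 ≤ 4) (by norm_num : 3 ≤ 4) (Real.pi / 3)
    ({((0 : ZMod 4), (0 : ZMod 4)), (1, 0), (3, 0), (0, 1), (0, 3), (1, 1)} : Finset (ZMod 4 × ZMod 4))
  rwa [card_fermiSea44] at h

/-- The twisted-minus-untwisted `F` sum in closed form:
`Σ_F (ε^{π/3} - ε) = 6 - 6cos(π/12) - 2cos(5π/12)` (only the `x`-factors change; three momenta with
`a = 0`, two with `a = 1`, one with `a = 3`). -/
private theorem sum_fermiSea44_twist_sub :
    ∑ k ∈ ({((0 : ZMod 4), (0 : ZMod 4)), (1, 0), (3, 0), (0, 1), (0, 3), (1, 1)} : Finset (ZMod 4 × ZMod 4)), tubeTwistedBand 4 4 (Real.pi / 3) k - ∑ k ∈ ({((0 : ZMod 4), (0 : ZMod 4)), (1, 0), (3, 0), (0, 1), (0, 3), (1, 1)} : Finset (ZMod 4 × ZMod 4)), tubeBand 4 4 k =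
      6 - 6 * Real.cos (Real.pi / 12) - 2 * Real.cos (5 * Real.pi / 12) := by
  rw [← Finset.sum_sub_distrib]
  have hterm : ∀ k : ZMod 4 × ZMod 4, k.1.val ≠ 2 →
      tubeTwistedBand 4 4 (Real.pi / 3) k - tubeBand 4 4 k =
        (if k.1.val = 0 then -2 * Real.cos (Real.pi / 12)
          else if k.1.val = 1 then -2 * Real.cos (5 * Real.pi / 12) else 2 * Real.cos (5 * Real.pi / 12)) -
        (if k.1.val = 0 then -2 else if k.1.val = 2 then 2 else 0) := by
    intro k hk
    rw [tubeTwistedBand_four_four, tubeBand_four_four, twistedBand_factor_four k.1.val_lt hk,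
      band_factor_four k.1.val_lt]
    ring
  rw [Finset.sum_insert (by decide), Finset.sum_insert (by decide), Finset.sum_insert (by decide),
    Finset.sum_insert (by decide), Finset.sum_insert (by decide), Finset.sum_singleton,
    hterm ((0 : ZMod 4), (0 : ZMod 4)) (by decide), hterm ((1 : ZMod 4), (0 : ZMod 4)) (by decide),
    hterm ((3 : ZMod 4), (0 : ZMod 4)) (by decide), hterm ((0 : ZMod 4), (1 : ZMod 4)) (by decide),
    hterm ((0 : ZMod 4), (3 : ZMod 4)) (by decide), hterm ((1 : ZMod 4), (1 : ZMod 4)) (by decide)]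
  norm_num [zv0, zv1, zv3]
  ring

/-- Numerics: `12 + 6/100 < 12cos(π/12) + 4cos(5π/12)` (from `cos x ≥ 1 - x²/2` and `π < 3.15`:
the right side is at least `16 - 7π²/18 > 12.14`). -/
private theorem twelve_cos_add_four_cos_gt :
    12 + 6 * (1 / 100 : ℝ) < 12 * Real.cos (Real.pi / 12) + 4 * Real.cos (5 * Real.pi / 12) := by
  have h1 := Real.one_sub_sq_div_two_le_cos (x := Real.pi / 12)
  have h5 := Real.one_sub_sq_div_two_le_cos (x := 5 * Real.pi / 12)
  have hpi := Real.pi_lt_d2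
  have hpi0 := Real.pi_pos
  nlinarith

/-- **The `4 × 4` Hubbard torus at `12` electrons is paramagnetic at the twist `π/3` for
`0 ≤ U ≤ 1/100`**: `E_{4,4}(U; π/3, 12) < E_{4,4}(U; 0, 12)` for every labelling (free Fermi-sea
comparison `2Σ_F(ε^{π/3} - ε) < -0.14` transferred by `tubeEnergy_le_free_add` / `tubeEnergy_free_le`).
[folklore] -/
theorem tubeEnergy_four_four_twist_lt (Λ : Type) [LinearOrder Λ] [Fintype Λ]
    (e : Λ ≃ ZMod 4 × ZMod 4) {U : ℝ} (hU0 : 0 ≤ U) (hU : U ≤ 1 / 100) :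
    tubeEnergy 4 4 Λ e U (Real.pi / 3) 12 < tubeEnergy 4 4 Λ e U 0 12 := by
  have hup : tubeEnergy 4 4 Λ e U (Real.pi / 3) 12 ≤ tubeEnergy 4 4 Λ e 0 (Real.pi / 3) 12 + U * 6 := by
    have h := tubeEnergy_le_free_add 4 4 Λ e U hU0 (Real.pi / 3) (n := 6) (by norm_num)
    norm_num at h
    exact h
  have hlo : tubeEnergy 4 4 Λ e 0 0 12 ≤ tubeEnergy 4 4 Λ e U 0 12 := by
    have h := tubeEnergy_free_le 4 4 Λ e U hU0 0 (n := 6) (by norm_num)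
    norm_num at h
    exact h
  have h0 := tubeEnergy_four_four_free_zero Λ e
  have h1 := tubeEnergy_four_four_free_twist_le Λ e
  have hdiff := sum_fermiSea44_twist_sub
  have hnum := twelve_cos_add_four_cos_gt
  linarith

/-- The crux filling of the `4 × 4` torus at `δ = 1/4` is `12`. -/
theorem tubeFilling_four_four_quarter : tubeFilling 4 4 (1 / 4) = 12 := by
  have h : (1 - (1 / 4 : ℝ)) * (((4 : ℕ) : ℝ) * ((4 : ℕ) : ℝ)) / 2 = (6 : ℕ) := by push_cast; norm_num
  rw [tubeFilling, h, Nat.floor_natCast]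

/-- **An interacting admissible glued tube with NEGATIVE twist stiffness**: `ρ̃_{4,4}(U, 1/4) < 0`
for `0 ≤ U ≤ 1/100` and every labelling — the hidden sign claim (i) of the crux fails at this size
and coupling. [cite: ScalapinoWhiteZhang1993, §II] -/
theorem tubeStiffness_four_four_neg (Λ : Type) [LinearOrder Λ] [Fintype Λ]
    (e : Λ ≃ ZMod 4 × ZMod 4) {U : ℝ} (hU0 : 0 ≤ U) (hU : U ≤ 1 / 100) :
    tubeStiffness 4 4 Λ e U (1 / 4) < 0 := by
  rw [tubeStiffness, tubeFilling_four_four_quarter]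
  have h := tubeEnergy_four_four_twist_lt Λ e hU0 hU
  apply div_neg_of_neg_of_pos
  · push_cast
    nlinarith
  · positivity

end FourByFour

/-! ### The threshold-free crux is false -/

open scoped Classical in
/-- **The disprover's near-miss `not_seamGluingLocalityAllSizes`, closed.** Verbatim negation of
`SeamGluingLocalityAllSizes` of `Cruxes/SeamGluingLocality/Disproof.lean` §3 (the crux with NO
thresholds, `M₂ = L₂ = 0`, factor `1`, stated over the crux's own `let`-prefix). Witness: `U = 1/100`,
`δ = 1/4`, `L = 4`, `M' = M'' = 2`, `M = 4`, canonical `Fin` carriers; conjunct (1) gives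
`0 ≤ max(min ρ̃' ρ̃'', 0) ≤ ρ̃_{4,4}(1/100, 1/4)`, contradicting `tubeStiffness_four_four_neg` (the
`let`-bound functional is definitionally `tubeStiffness`, `WidthHaldaneDefs`). [folklore] -/
theorem not_seamGluingLocality_allSizes :
    ¬ (open Matrix Literature.MathematicalPhysics.QuantumLattice in let H0 : ∀ (L M : ℕ) (Λ : Type) [LinearOrder Λ] [Fintype Λ], (Λ ≃ ZMod L × ZMod M) → ℝ → Matrix (Finset (Orb Λ)) (Finset (Orb Λ)) ℂ := fun _ _ Λ _ _ e U => hamiltonian (SimpleGraph.fromRel fun x y : Λ => y = e.symm ((e x).1 + 1, (e x).2) ∨ y = e.symm ((e x).1, (e x).2 + 1)) 1 U; let Tw : ∀ (L M : ℕ) [NeZero L] [NeZero M] (Λ : Type) [LinearOrder Λ] [Fintype Λ], (Λ ≃ ZMod L × ZMod M) → ℝ → Matrix (Finset (Orb Λ)) (Finset (Orb Λ)) ℂ := fun _ M _ _ _ _ _ e θ => ∑ b : ZMod M, ∑ σ : Fin 2, ((1 - Complex.exp (Complex.I * θ)) • (creation (orb (e.symm (0, b)) σ) * annihilation (orb (e.symm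 (-1, b)) σ)) + (1 - Complex.exp (-(Complex.I * θ))) • (creation (orb (e.symm (-1, b)) σ) * annihilation (orb (e.symm (0, b)) σ))); let E : ∀ (L M : ℕ) [NeZero L] [NeZero M] (Λ : Type) [LinearOrder Λ] [Fintype Λ], (Λ ≃ ZMod L × ZMod M) → ℝ → ℝ → ℕ → ℝ := fun L M _ _ Λ _ _ e U θ N => (H0 L M Λ e U + Tw L M Λ e θ).minEnergyOn (szSector N 0); let Np : ℕ → ℕ → ℝ → ℕ := fun L M δ => 2 * ⌊(1 - δ) * ((L : ℝ) * (M : ℝ)) / 2⌋₊; let stiff : ∀ (L M : ℕ) [NeZero L] [NeZero M] (Λ : Type) [LinearOrder Λ] [Fintype Λ], (Λ ≃ ZMod L × ZMod M) → ℝ → ℝ → ℝ := fun L M _ _ Λ _ _ e U δ => 2 * (L : ℝ) * (E L M Λ e U (Real.pi / 3) (Np L M δ) - E L M Λ e U 0 (Np L M δ)) / ((Real.pi / 3) ^ 2 * (M : ℝ)); let icomp : ∀ (L M : ℕ) [NeZero L] [NeZero M] (Λ : Type) [LinearOrder Λ] [Fintype Λ], (Λ ≃ ZMod L × ZMod M)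 → ℝ → ℝ → ℝ := fun L M _ _ Λ _ _ e U δ => (L : ℝ) * (M : ℝ) * (E L M Λ e U 0 (Np L M δ + 2) + E L M Λ e U 0 (Np L M δ - 2) - 2 * E L M Λ e U 0 (Np L M δ)) / 4; ∀ U : ℝ, 0 < U → ∀ δ ∈ Set.Ioo (0 : ℝ) (3 / 10), ∀ (L M' M'' M : ℕ) [NeZero L] [NeZero M'] [NeZero M''] [NeZero M], Even L → Even M' → Even M'' → M' + M'' = M → M ≤ L → ∀ (Λ' : Type) [LinearOrder Λ'] [Fintype Λ'] (e' : Λ' ≃ ZMod L × ZMod M') (Λ'' : Type) [LinearOrder Λ''] [Fintype Λ''] (e'' : Λ'' ≃ ZMod L × ZMod M'') (Λ : Type) [LinearOrder Λ] [Fintype Λ] (e : Λ ≃ ZMod L × ZMod M), max (min (stiff L M' Λ' e' U δ) (stiff L M'' Λ'' e'' U δ)) 0 ≤ stiff L M Λ e U δ ∧ max (min (icomp L M' Λ' e' U δ) (icomp L M'' Λ'' e'' U δ)) 0 ≤ icomp L M Λ e U δ ∧ icomp L M Λ e U δ ≤ max (max (icomp L M' Λ' e' U δ) (icomp L M'' Λ''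 e'' U δ)) 0) := by
  intro h
  have e8 : Fin (4 * 2) ≃ ZMod 4 × ZMod 2 :=
    finProdFinEquiv.symm.trans (Equiv.prodCongr (ZMod.finEquiv 4).toEquiv (ZMod.finEquiv 2).toEquiv)
  have e16 : Fin (4 * 4) ≃ ZMod 4 × ZMod 4 :=
    finProdFinEquiv.symm.trans (Equiv.prodCongr (ZMod.finEquiv 4).toEquiv (ZMod.finEquiv 4).toEquiv)
  obtain ⟨h1, -, -⟩ := h (1 / 100) (by norm_num) (1 / 4) ⟨by norm_num, by norm_num⟩ 4 2 2 4
    (by decide) (by decide) (by decide) rfl le_rfl (Fin (4 * 2)) e8 (Fin (4 * 2)) e8 (Fin (4 * 4)) e16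
  have h0 : (0 : ℝ) ≤ tubeStiffness 4 4 (Fin (4 * 4)) e16 (1 / 100) (1 / 4) :=
    le_trans (le_max_right _ _) h1
  exact absurd h0 (not_le.mpr (tubeStiffness_four_four_neg (Fin (4 * 4)) e16 (by norm_num) le_rfl))

end Summit.HubbardSuperconductivity.HubbardSuperconductivity.Theorems.SeamGluingLocality.Negative

end
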